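import Summits.SmoothPoincare4.SmoothPoincare4.Theses.BachCriticalElement
import Literature.Topology.FourManifolds.Morse
import HarnessLib

/-!
# Line `birth` — BC3 skeleton for the crux `BachCriticalElement.PscOnHomotopySpheres` (stmt-SmoothPoincare4-4395)

Route `route-SmoothPoincare4-BachCriticalElement` (rank-3 crux, shared in content with route PIC's
`PicPscV2` = stmt-SmoothPoincare4-0442), decl
`Summit.SmoothPoincare4.SmoothPoincare4.Theses.BachCriticalElement.PscOnHomotopySpheres`:

  every smooth homotopy 4-sphere `M` (Hausdorff, second countable, `C^∞` atlas on `ℝ⁴`,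
  `M ≃ₕ S⁴` — the bare carriers of `SmoothPoincare4`) carries a `C^∞` Riemannian metric `g`
  (with its Levi-Civita connection) of everywhere POSITIVE SCALAR CURVATURE.

Standing of the crux (item notes, refuter/grounder 2026-08-15): open — Gromov–Lawson/Stolz give PSC
on simply connected non-spin or spin-with-`α = 0` manifolds only in dimension `≥ 5`; in dimension 4
PSC on a GIVEN smooth homotopy sphere is known only up to homeomorphism (KumarSen2025 Obs. 9);
`SmoothPoincare4 → PscOnHomotopySpheres` (pull back the round metric) is the trivial direction.
No `Disproof.lean`, no crux workfiles, no landed `Theorems/PscOnHomotopySpheres/Negative/*`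
(`ledger crux ls stmt-SmoothPoincare4-4395`: none, 2026-08-17).

## The line: presentation spheres are PSC (Gromov–Lawson surgery in handle form)

The only known ENGINE producing positive scalar curvature on an unknown manifold is surgery /
handle attachment in codimension `≥ 3` (Gromov–Lawson 1980, Thm. A; independently Schoen–Yau
1979; for handlebodies and regular neighbourhoods: Gajer 1987, Carr 1988).  In dimension 4 it
reaches exactly the closed 4-manifolds obtained from `⊔ S⁴` by `0`- and `1`-surgeries, i.e. the
BOUNDARIES OF COMPACT 5-DIMENSIONAL HANDLEBODIES WITH HANDLES OF INDEX `≤ 2` (attaching a 5-dimensional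
`i`-handle performs an `(i-1)`-surgery, of codimension `5 - i ≥ 3` iff `i ≤ 2`, on the boundary).
A homotopy 4-sphere of this form is a PRESENTATION SPHERE `∂N⁵(P, ε)` (`P` a balanced presentation of
the trivial group, `N⁵(P, ε) = D⁵ ∪ k h¹ ∪ k h²` contractible; equivalently the double `D(Δ) = ∂(Δ × I)`
of a contractible 4-dimensional 2-handlebody `Δ`).  Whether EVERY homotopy 4-sphere is a presentation
sphere is open and is already a shared, refuter-checked item of this summit
(stmt-SmoothPoincare4-3720 = `RicciTranscript.PresentationSphere` =
`EntropyLadder.BoundsContractibleTwoHandlebody`, also wanted by `ConvexityLadder`).  So the crux splits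
as the BRIDGE

  `PscOnHomotopySpheres ⇐ PresentationSphere ∧ (∂(5-dimensional 2-handlebody) is PSC)`,

with a purely TOPOLOGICAL open leaf (no metric in it) and a purely GEOMETRIC known leaf (no homotopy
sphere in it):

* `stub_presentationSphere` — **OPEN (the bet; = stmt-SmoothPoincare4-3720 VERBATIM):** every smooth
  homotopy 4-sphere `M` (summit binder) bounds a compact contractible smooth 5-manifold `W` carrying a
  Morse function adapted to `∂W` all of whose critical points have index `≤ 2`
  (`IsHandlebodyOfIndexLE 4 2 W` unfolded), `M → W` a smooth embedding onto `(𝓡∂ 5).boundary W`.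
  Implied by `SmoothPoincare4` (`S⁴ = ∂D⁵`); implies the crux (this file); NOT known to imply
  `SmoothPoincare4` (that is the separate open item stmt-SmoothPoincare4-3717,
  `PresentationSpheresStandard`: `∂N⁵(P, ε) ≅ S⁴` is known only for Andrews–Curtis-trivial `P` and
  for the Akbulut–Kirby/Gompf family).  Why it might fail: only `{2,3}`-fillings of a homotopy
  4-sphere are guaranteed (the h-cobordism to `S⁴`, `Θ₄ = 0`); a `{1,2}`-filling forgets all
  4-dimensional knotting; moreover `∂(Δ × I)` is AMPHICHIRAL (the reflection of `I`), so ONE chiral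
  exotic homotopy 4-sphere refutes this stub without touching the crux.  Sources: AndrewsCurtis1965,
  AkbulutKirby1985, Kirby1989 (Ch. I §2, p. 18), Gompf1991Killing, FreedmanGompfMorrisonWalker2010
  (Fact 2), HogAngeloniMetzler1993.  Size: open problem (shared by three routes).
* `stub_pscBoundaryOfTwoHandlebody` — **KNOWN, deep (Gromov–Lawson 1980 Thm. A / Schoen–Yau 1979 /
  Gajer 1987 / Carr 1988; XL to formalise):** if `W` is a compact Hausdorff second-countable smooth
  5-manifold with boundary carrying a Morse function adapted to `∂W` with all critical indices `≤ 2`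
  (so `W ≅ ⊔D⁵ ∪ 1-handles ∪ 2-handles`, Milnor 1963 Thms. 3.1–3.2, Kosinski VII 1.1–1.2), and `M`
  is a Hausdorff second-countable smooth 4-manifold (modelled on `ℝ⁴`) smoothly embedded onto
  `∂W`, then `M` carries a `C^∞` Riemannian metric with Levi-Civita connection and `scal > 0`
  everywhere.  Proof in print: `∂(⊔D⁵) = ⊔S⁴` is round-PSC; each 1-handle changes the boundary by
  a `0`-surgery (connected sum, or `# S¹×S³` / `# S¹×~S³`), each 2-handle by a surgery on an embedded
  circle with trivialised normal bundle — both of codimension `≥ 3` in the 4-dimensional boundary,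
  so PSC propagates (Gromov–Lawson 1980, Thm. A: "any manifold obtained from a PSC manifold by
  surgeries in codimension `≥ 3` carries PSC"; Schoen–Yau 1979); finally pull the metric
  back along the diffeomorphism `M ≅ ∂W` given by the embedding.  NO homotopy-sphere and NO
  contractibility hypothesis: the statement is about arbitrary boundaries of 5-dimensional
  2-handlebodies (e.g. `#k(S¹×S³)`, `∂N⁵(P,ε)` for ANY finite presentation `P`).  Degenerate case
  `W = ∅ ⇒ M = ∅` holds vacuously (the empty section is a metric).  Why it might fail: it does not
  (published theorem); the risks are formalisation size only (handle decomposition from the Morse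
  function, Gromov–Lawson's bending lemma, gluing of metrics).  Sources: GromovLawson1980 (Thm. A),
  SchoenYau1979 (Manuscripta Math. 28), Gajer 1987 (Ann. Global Anal. Geom. 5), Carr 1988 (Trans.
  AMS 307), Milnor1963 (§3), Kosinski1993 (VII).
* `psc_of_stubs` — the REAL composition (sorry-free, pure logic): given `M ≃ₕ S⁴`, stub 1 yields
  `W`, its Morse data and the boundary embedding `φ`; stub 2 applied to `(W, M, φ)` yields the metric.
  Its conclusion is the crux's body for the given `M` (pointwise), so that exactly ONE theorem of this
  file concludes the crux by name:
* `PscOnHomotopySpheres_of : PscOnHomotopySpheres` — THE skeleton theorem: the crux BY NAME from the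
  two declared stubs (the only `sorry`s of the file) through `psc_of_stubs`.

What this line adds to the summit's implication graph: the edge `PresentationSphere (3720) ⇒
PscOnHomotopySpheres (4395 ≡ PIC's 0442)`: every presentation sphere `∂N⁵(P, ε)` — in particular every
potential counterexample to SPC4 coming from a balanced presentation (Akbulut–Kirby / Cappell–Shaneson
doubles, `Σ # Σ̄` of a 3-handle-free homotopy sphere `Σ`, FGMW 2010 Fact 2) — carries positive scalar
curvature, hence enters the Yamabe-positive cone where route BachCriticalElement's Weyl-energy
programme (and route PIC, and WeylBudget's `WeylLight`) operates.

BC3 probes (planner folder `bc/probe_stub1.lean`, `bc/probe_stub2.lean`, 2026-08-17): for each stub,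
`stub → PscOnHomotopySpheres` and `stub → SmoothPoincare4` by `first | exact? | simpa | aesop` FAIL
(stub 1 never mentions a metric, stub 2 never mentions a homotopy sphere; no landed theorem links
either to the crux or the summit).  Converse directions for the record: `SmoothPoincare4 ⇒ stub 1`
(true, `S⁴ = ∂D⁵`, not cheap in Lean), `stub 2` is a theorem.  Disproof used: none exists for this
crux.  Negatives index (`ledger negatives --problem SmoothPoincare4`): no refuted statement about
presentation spheres / handlebody boundaries / PSC existence — neither stub is an instance of a
refuted statement.
-/

noncomputable section

open scoped Manifold ContDiff Topology ContinuousMap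
open Summit.SmoothPoincare4.SmoothPoincare4.Theses.BachCriticalElement (PscOnHomotopySpheres)

-- `Summit.<Summit>.<Problem>`: for the single-conjunct summit the duplicate segment is mandated.
set_option linter.dupNamespace false
set_option linter.unusedVariables false

namespace Summit.SmoothPoincare4.SmoothPoincare4.Cruxes.PscOnHomotopySpheres.Birth

/-! ## The two registered stubs (`sorry` lives ONLY here) -/

/-- **Stub 1 (OPEN — the bet): every smooth homotopy 4-sphere is a presentation sphere**, i.e.
bounds a compact contractible smooth 5-manifold `W` with a Morse function adapted to `∂W` all of whose
critical points have index `≤ 2` (`W = N⁵(P, ε)` for a balanced presentation `P` of the trivial group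
after `0/1`-cancellation; equivalently `M ≅ D(Δ) = ∂(Δ × I)` for a contractible 4-dimensional
2-handlebody `Δ`).  The signature is VERBATIM the shared item stmt-SmoothPoincare4-3720
(`RicciTranscript.PresentationSphere` / `EntropyLadder.BoundsContractibleTwoHandlebody` /
ConvexityLadder), refuter-checked open: a proof of that item closes this stub by `exact`.
Implied by `SmoothPoincare4`; not known to imply it (that is stmt-SmoothPoincare4-3717).  Why it
might fail: only `{2,3}`-fillings are guaranteed by `Θ₄ = 0`; a `{1,2}`-filling forgets 4-dimensional
knotting, and `∂(Δ × I)` is amphichiral — a chiral exotic homotopy 4-sphere, or one all of whose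
contractible fillings need 3-handles, refutes the stub (not the crux).
[cite: AndrewsCurtis1965] [cite: AkbulutKirby1985] [cite: Kirby1989, Ch. I §2, p. 18]
[cite: Gompf1991Killing] [cite: FreedmanGompfMorrisonWalker2010, Fact 2] -/
theorem stub_presentationSphere :
    ∀ (M : Type) [TopologicalSpace M] [T2Space M] [SecondCountableTopology M] [ChartedSpace (EuclideanSpace ℝ (Fin 4)) M] [IsManifold (𝓡 4) ∞ M], M ≃ₕ Metric.sphere (0 : EuclideanSpace ℝ (Fin 5)) 1 → ∃ (W : Type) (_ : TopologicalSpace W) (_ : T2Space W) (_ : SecondCountableTopology W) (_ : ChartedSpace (EuclideanHalfSpace (4 + 1)) W) (_ : IsManifold (𝓡∂ (4 + 1)) ∞ W) (_ : CompactSpace W), ContractibleSpace W ∧ (∃ f : W → ℝ, Literature.Topology.FourManifolds.IsMorseAdapted (𝓡∂ (4 + 1)) f ∧ ∀ z, Literature.Topology.FourManifolds.IsMCriticalPt (𝓡∂ (4 + 1)) f z → Literature.Topology.FourManifolds.morseIndex (𝓡∂ (4 + 1)) f z ≤ 2) ∧ ∃ φ : M → W, Manifold.IsSmoothEmbedding (𝓡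 4) (𝓡∂ (4 + 1)) ∞ φ ∧ Set.range φ = (𝓡∂ (4 + 1)).boundary W := by
  sorry

/-- **Stub 2 (KNOWN, deep — Gromov–Lawson's surgery theorem in handle form): the boundary of a compact
5-dimensional handlebody with handles of index `≤ 2` carries positive scalar curvature.**  If `W` is a
compact Hausdorff second-countable smooth 5-manifold with boundary carrying a Morse function adapted to
`∂W` all of whose critical points have index `≤ 2` (`W ≅ ⊔D⁵ ∪ 1-handles ∪ 2-handles`, Milnor 1963
§3), and `M` is a Hausdorff second-countable smooth 4-manifold smoothly embedded onto `∂W`, then `M`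
carries a `C^∞` Riemannian metric (with Levi-Civita connection) of everywhere positive scalar
curvature: `∂W` is obtained from `⊔S⁴` (round, PSC) by `0`-surgeries (1-handles) and surgeries on
embedded circles (2-handles), all of codimension `≥ 3` in `∂W`, so PSC propagates by Gromov–Lawson
1980 Thm. A / Schoen–Yau 1979 (handlebody form: Gajer 1987, Carr 1988), and is pulled back
along `M ≅ ∂W`.  No homotopy-sphere or contractibility hypothesis; `W = ∅` is vacuous.  Why it might
fail: published theorem — formalisation size only (XL: handles from the Morse function, the
Gromov–Lawson bending lemma, metric gluing).
[cite: GromovLawson1980, Thm. A] [cite: SchoenYau1979] [cite: Milnor1963, §3]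
[cite: Kosinski1993, VII.1.1–1.2] -/
theorem stub_pscBoundaryOfTwoHandlebody :
    ∀ (W : Type) [TopologicalSpace W] [T2Space W] [SecondCountableTopology W] [ChartedSpace (EuclideanHalfSpace (4 + 1)) W] [IsManifold (𝓡∂ (4 + 1)) ∞ W] [CompactSpace W], (∃ f : W → ℝ, Literature.Topology.FourManifolds.IsMorseAdapted (𝓡∂ (4 + 1)) f ∧ ∀ z, Literature.Topology.FourManifolds.IsMCriticalPt (𝓡∂ (4 + 1)) f z → Literature.Topology.FourManifolds.morseIndex (𝓡∂ (4 + 1)) f z ≤ 2) → ∀ (M : Type) [TopologicalSpace M] [T2Space M] [SecondCountableTopology M] [ChartedSpace (EuclideanSpace ℝ (Fin 4)) M] [IsManifold (𝓡 4) ∞ M] (φ : M → W), Manifold.IsSmoothEmbedding (𝓡 4) (𝓡∂ (4 + 1)) ∞ φ → Set.range φ = (𝓡∂ (4 + 1)).boundary W → ∃ g : Literature.Geometry.Lorentzian.PseudoRiemannianMetric (𝓡 4) ∞ (EuclideanSpace ℝ (Fin 4)) (TangentSpace (𝓡 4) : M → Type _), ∃ _ : g.HasLeviCivita, g.IsRiemannian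 ∧ ∀ x, 0 < g.scalarCurvature x := by
  sorry

/-! ## The composition: the two stubs prove the crux BY NAME (no `sorry` below this line) -/

/-- **Composition with explicit hypotheses** (the BC3 shape `stub₁-sig → stub₂-sig → crux`, stated
pointwise in the homotopy sphere so that `PscOnHomotopySpheres_of` is the only theorem of the file
concluding the crux by name): a homotopy 4-sphere bounds a compact 5-dimensional 2-handlebody `W`
(stub 1) and the boundary of such a `W` carries positive scalar curvature (stub 2).  Pure logic.
[cite: GromovLawson1980, Thm. A] -/
theorem psc_of_stubs
    (hPS : ∀ (M : Type) [TopologicalSpace M] [T2Space M] [SecondCountableTopology M] [ChartedSpace (EuclideanSpace ℝ (Fin 4)) M] [IsManifold (𝓡 4) ∞ M], M ≃ₕ Metric.sphere (0 : EuclideanSpace ℝ (Fin 5)) 1 → ∃ (W : Type) (_ : TopologicalSpace W) (_ : T2Space W) (_ : SecondCountableTopology W) (_ : ChartedSpace (EuclideanHalfSpace (4 + 1)) W) (_ : IsManifold (𝓡∂ (4 + 1)) ∞ W) (_ : CompactSpace W), ContractibleSpace W ∧ (∃ f : W → ℝ, Literature.Topology.FourManifolds.IsMorseAdapted (𝓡∂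 (4 + 1)) f ∧ ∀ z, Literature.Topology.FourManifolds.IsMCriticalPt (𝓡∂ (4 + 1)) f z → Literature.Topology.FourManifolds.morseIndex (𝓡∂ (4 + 1)) f z ≤ 2) ∧ ∃ φ : M → W, Manifold.IsSmoothEmbedding (𝓡 4) (𝓡∂ (4 + 1)) ∞ φ ∧ Set.range φ = (𝓡∂ (4 + 1)).boundary W)
    (hGL : ∀ (W : Type) [TopologicalSpace W] [T2Space W] [SecondCountableTopology W] [ChartedSpace (EuclideanHalfSpace (4 + 1)) W] [IsManifold (𝓡∂ (4 + 1)) ∞ W] [CompactSpace W], (∃ f : W → ℝ, Literature.Topology.FourManifolds.IsMorseAdapted (𝓡∂ (4 + 1)) f ∧ ∀ z, Literature.Topology.FourManifolds.IsMCriticalPt (𝓡∂ (4 + 1)) f z → Literature.Topology.FourManifolds.morseIndex (𝓡∂ (4 + 1)) f z ≤ 2) → ∀ (M : Type) [TopologicalSpace M] [T2Space M] [SecondCountableTopology M] [ChartedSpace (EuclideanSpace ℝ (Fin 4)) M] [IsManifold (𝓡 4) ∞ M] (φ : M → W), Manifold.IsSmoothEmbedding (𝓡 4) (𝓡∂ (4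 + 1)) ∞ φ → Set.range φ = (𝓡∂ (4 + 1)).boundary W → ∃ g : Literature.Geometry.Lorentzian.PseudoRiemannianMetric (𝓡 4) ∞ (EuclideanSpace ℝ (Fin 4)) (TangentSpace (𝓡 4) : M → Type _), ∃ _ : g.HasLeviCivita, g.IsRiemannian ∧ ∀ x, 0 < g.scalarCurvature x)
    (M : Type) [TopologicalSpace M] [T2Space M] [SecondCountableTopology M]
    [ChartedSpace (EuclideanSpace ℝ (Fin 4)) M] [IsManifold (𝓡 4) ∞ M]
    (e : M ≃ₕ Metric.sphere (0 : EuclideanSpace ℝ (Fin 5)) 1) :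
    ∃ g : Literature.Geometry.Lorentzian.PseudoRiemannianMetric (𝓡 4) ∞ (EuclideanSpace ℝ (Fin 4))
        (TangentSpace (𝓡 4) : M → Type _),
      ∃ _ : g.HasLeviCivita, g.IsRiemannian ∧ ∀ x, 0 < g.scalarCurvature x := by
  -- stub 1: a compact (contractible) 5-dimensional 2-handlebody `W` with `∂W ≅ M`
  obtain ⟨W, _, _, _, _, _, _, _hW, hf, φ, hφ, hrange⟩ := hPS M e
  -- stub 2: Gromov–Lawson on `(W, M, φ)`
  exact hGL W hf M φ hφ hrange

/-- **THE SKELETON THEOREM.** The crux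
`Summit.SmoothPoincare4.SmoothPoincare4.Theses.BachCriticalElement.PscOnHomotopySpheres`, concluded BY
NAME from the two DECLARED stubs `stub_presentationSphere`, `stub_pscBoundaryOfTwoHandlebody` (the
only `sorry`s of the file) through the sorry-free composition `psc_of_stubs`.
[cite: GromovLawson1980, Thm. A] -/
theorem PscOnHomotopySpheres_of : PscOnHomotopySpheres := by
  intro M _ _ _ _ _ e
  exact psc_of_stubs stub_presentationSphere stub_pscBoundaryOfTwoHandlebody M e

end Summit.SmoothPoincare4.SmoothPoincare4.Cruxes.PscOnHomotopySpheres.Birth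

end
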